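import Mathlib
/-! # Stub `stub_dissocCount` — crux `TwoProducts` (stmt-ValiantsHypothesis-5906), line `corner-log-linearization`

Counting step of the dissociated engine (rung piece R4).  The exponent vectors
`e = Σₐ m(a) • a` of multisets `m` of size `≤ d` supported on a letter set `Rw w` of size `≤ d`
that depends on the positive integer weight `w` only through the weak order `w` induces on the
letters `U ⊂ ℕ²` number at most `(|U|² + 2) · ((d + 1) · 4 ^ d)`.

* Cells.  For `w₁ > 0` the comparison `w₀ b₀ + w₁ b₁ ≤ w₀ a₀ + w₁ a₁` only depends on the
  position of `ρ = w₀ / w₁ ∈ ℚ` relative to the critical value `(a₁ - b₁) / (b₀ - a₀)` of the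
  pair (when `a₀ ≠ b₀`; otherwise it does not depend on `w`).  The position of `ρ` relative to
  every element of the finite set `Q` of critical values is determined by the cell
  `(#{q ∈ Q | q < ρ}, [ρ ∈ Q]) ∈ {0, …, |Q|} × Bool`, and `2 (|Q| + 1) ≤ |U|² + 2` because only
  pairs with `a₀ < b₀` are needed.
* Multisets.  `#(R.finsuppAntidiag j) = C(|R| + j - 1, j) ≤ 2 ^ (2 d) = 4 ^ d` for `|R|, j ≤ d`
  (stars and bars, from Mathlib), summed over `j ≤ d`.
[folklore] -/
set_option linter.dupNamespace false -- single-conjunct summit: `ValiantsHypothesis.ValiantsHypothesis`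
namespace Summit.ValiantsHypothesis.ValiantsHypothesis.Theorems.TwoProducts.DissocCount
open scoped BigOperators

/-! ## Cells of a ratio against a finite set of critical values -/

/-- If `#{q ∈ Q | q < ρ} = #{q ∈ Q | q < ρ'}` then every critical value below `ρ` is below `ρ'`.
[folklore] -/
theorem lt_of_card_filter_lt_eq (Q : Finset ℚ) (ρ ρ' : ℚ)
    (h : (Q.filter (· < ρ)).card = (Q.filter (· < ρ')).card) {q : ℚ} (hq : q ∈ Q)
    (hlt : q < ρ) : q < ρ' := by
  by_contra hn
  have hle : ρ' ≤ q := not_lt.mp hn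
  have hsub : Q.filter (· < ρ') ⊆ Q.filter (· < ρ) := by
    intro x hx
    rw [Finset.mem_filter] at hx ⊢
    exact ⟨hx.1, (hx.2.trans_le hle).trans hlt⟩
  have hss : Q.filter (· < ρ') ⊂ Q.filter (· < ρ) :=
    (Finset.ssubset_iff_of_subset hsub).mpr
      ⟨q, Finset.mem_filter.mpr ⟨hq, hlt⟩, fun hx => hn (Finset.mem_filter.mp hx).2⟩
  exact absurd h (Finset.card_lt_card hss).ne'

/-- Two critical values in the same cell coincide. [folklore] -/
theorem eq_of_cell_eq (Q : Finset ℚ) (ρ ρ' : ℚ)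
    (h : (Q.filter (· < ρ)).card = (Q.filter (· < ρ')).card) (hρ : ρ ∈ Q) (hρ' : ρ' ∈ Q) :
    ρ = ρ' := by
  rcases lt_trichotomy ρ ρ' with hlt | heq | hgt
  · exact absurd (lt_of_card_filter_lt_eq Q ρ' ρ h.symm hρ hlt) (lt_irrefl _)
  · exact heq
  · exact absurd (lt_of_card_filter_lt_eq Q ρ ρ' h hρ' hgt) (lt_irrefl _)

/-- Two ratios in the same cell `(#{q ∈ Q | q < ρ}, [ρ ∈ Q])` sit the same way relative to every
critical value `q ∈ Q`. [folklore] -/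
theorem trichotomy_of_cell_eq (Q : Finset ℚ) (ρ ρ' : ℚ)
    (h : (Q.filter (· < ρ)).card = (Q.filter (· < ρ')).card) (hβ : (ρ ∈ Q ↔ ρ' ∈ Q))
    {q : ℚ} (hq : q ∈ Q) : (q < ρ ↔ q < ρ') ∧ (q = ρ ↔ q = ρ') := by
  refine ⟨⟨lt_of_card_filter_lt_eq Q ρ ρ' h hq, lt_of_card_filter_lt_eq Q ρ' ρ h.symm hq⟩,
    ?_, ?_⟩
  · rintro rfl
    exact eq_of_cell_eq Q q ρ' h hq (hβ.mp hq)
  · rintro rfl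
    exact (eq_of_cell_eq Q ρ q h (hβ.mpr hq) hq).symm

/-! ## Weight comparisons as positions of the ratio `w₀ / w₁` -/

/-- For `w₁ > 0` the weight comparison `w₀ b₀ + w₁ b₁ ≤ w₀ a₀ + w₁ a₁` reads
`ρ (b₀ - a₀) ≤ a₁ - b₁` with `ρ = w₀ / w₁ ∈ ℚ`. [folklore] -/
theorem cmp_iff_ratio (w : Fin 2 → ℤ) (hw : 0 < w 1) (a b : Fin 2 →₀ ℕ) :
    (w 0 * (b 0 : ℤ) + w 1 * (b 1 : ℤ) ≤ w 0 * (a 0 : ℤ) + w 1 * (a 1 : ℤ) ↔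
      (w 0 : ℚ) / w 1 * ((b 0 : ℚ) - a 0) ≤ (a 1 : ℚ) - b 1) := by
  have hw' : (0 : ℚ) < w 1 := by exact_mod_cast hw
  rw [div_mul_eq_mul_div, div_le_iff₀ hw']
  constructor
  · intro h
    have h' : ((w 0 * (b 0 : ℤ) + w 1 * (b 1 : ℤ) : ℤ) : ℚ) ≤
        ((w 0 * (a 0 : ℤ) + w 1 * (a 1 : ℤ) : ℤ) : ℚ) := by exact_mod_cast h
    push_cast at h'
    linarith
  · intro h
    have h' : ((w 0 * (b 0 : ℤ) + w 1 * (b 1 : ℤ) : ℤ) : ℚ) ≤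
        ((w 0 * (a 0 : ℤ) + w 1 * (a 1 : ℤ) : ℤ) : ℚ) := by
      push_cast
      linarith
    exact_mod_cast h'

/-- The position of `ρ` relative to the critical value `(a₁ - b₁) / (b₀ - a₀)` decides the
comparison `ρ (b₀ - a₀) ≤ a₁ - b₁`; for `a₀ = b₀` the comparison does not depend on `ρ`.
[folklore] -/
theorem ratio_cmp_transfer (ρ ρ' : ℚ) (a b : Fin 2 →₀ ℕ)
    (H : a 0 ≠ b 0 →
      ((((a 1 : ℚ) - b 1) / ((b 0 : ℚ) - a 0) < ρ ↔ ((a 1 : ℚ) - b 1) / ((b 0 : ℚ) - a 0) < ρ') ∧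
        (((a 1 : ℚ) - b 1) / ((b 0 : ℚ) - a 0) = ρ ↔
          ((a 1 : ℚ) - b 1) / ((b 0 : ℚ) - a 0) = ρ'))) :
    (ρ * ((b 0 : ℚ) - a 0) ≤ (a 1 : ℚ) - b 1 ↔ ρ' * ((b 0 : ℚ) - a 0) ≤ (a 1 : ℚ) - b 1) := by
  rcases lt_trichotomy (a 0) (b 0) with hlt | heq | hgt
  · have hδ : (0 : ℚ) < (b 0 : ℚ) - a 0 := by
      have : ((a 0 : ℕ) : ℚ) < (b 0 : ℕ) := by exact_mod_cast hlt
      linarith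
    obtain ⟨h1, -⟩ := H hlt.ne
    rw [← le_div_iff₀ hδ, ← le_div_iff₀ hδ, ← not_lt, ← not_lt]
    exact not_congr h1
  · rw [heq, sub_self, mul_zero, mul_zero]
  · have hδ : (b 0 : ℚ) - a 0 < 0 := by
      have : ((b 0 : ℕ) : ℚ) < (a 0 : ℕ) := by exact_mod_cast hgt
      linarith
    obtain ⟨h1, h2⟩ := H hgt.ne'
    rw [← div_le_iff_of_neg hδ, ← div_le_iff_of_neg hδ, le_iff_lt_or_eq, le_iff_lt_or_eq, h1, h2]

/-! ## Counting pairs -/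

/-- At most half of the ordered pairs of letters `(a, b)` have `a₀ < b₀`. [folklore] -/
theorem two_mul_card_filter_lt_le (U : Finset (Fin 2 →₀ ℕ)) :
    2 * ((U ×ˢ U).filter (fun p => p.1 0 < p.2 0)).card ≤ U.card ^ 2 := by
  have hsum := Finset.card_filter_add_card_filter_not (s := U ×ˢ U) (fun p => p.1 0 < p.2 0)
  have hle : ((U ×ˢ U).filter (fun p => p.1 0 < p.2 0)).card ≤
      ((U ×ˢ U).filter (fun p => ¬ p.1 0 < p.2 0)).card := by
    rw [← Finset.card_map ⟨Prod.swap, Prod.swap_injective⟩]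
    refine Finset.card_le_card fun p hp => ?_
    obtain ⟨x, hx, rfl⟩ := Finset.mem_map.mp hp
    rw [Finset.mem_filter, Finset.mem_product] at hx
    simp only [Function.Embedding.coeFn_mk, Finset.mem_filter, Finset.mem_product, Prod.fst_swap,
      Prod.snd_swap]
    exact ⟨⟨hx.1.2, hx.1.1⟩, not_lt.mpr hx.2.le⟩
  rw [Finset.card_product, ← sq] at hsum
  omega

/-! ## The count -/

/-- **R4 (cells × multisets).**  If the letter sets `Rw w ⊆ U` have size `≤ d` and depend on the
weight `w` only through the weak order `a ↦ w₀ a₀ + w₁ a₁` induces on `U`, then the exponent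
vectors `Σₐ m(a) • a` of the multisets `m` of size `≤ d` supported on `Rw w`, over all positive
weights `w`, number at most `(|U|² + 2) · ((d + 1) · 4 ^ d)`. [folklore] -/
theorem stub_dissocCount : ∀ (d : ℕ) (U : Finset (Fin 2 →₀ ℕ)) (Rw : (Fin 2 → ℤ) → Finset (Fin 2 →₀ ℕ)),
    (∀ w, Rw w ⊆ U) → (∀ w, (Rw w).card ≤ d) →
    (∀ w w' : Fin 2 → ℤ,
      (∀ a ∈ U, ∀ b ∈ U, (w 0 * (b 0 : ℤ) + w 1 * (b 1 : ℤ) ≤ w 0 * (a 0 : ℤ) + w 1 * (a 1 : ℤ) ↔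
        w' 0 * (b 0 : ℤ) + w' 1 * (b 1 : ℤ) ≤ w' 0 * (a 0 : ℤ) + w' 1 * (a 1 : ℤ))) → Rw w = Rw w') →
    {e : Fin 2 →₀ ℕ | ∃ w : Fin 2 → ℤ, 0 < w 0 ∧ 0 < w 1 ∧ ∃ m : (Fin 2 →₀ ℕ) →₀ ℕ,
      m.support ⊆ Rw w ∧ (m.sum fun _ k => k) ≤ d ∧ (m.sum fun a k => k • a) = e}.ncard
      ≤ (U.card ^ 2 + 2) * ((d + 1) * 4 ^ d) := by
  intro d U Rw _ hcard hdep
  classical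
  -- critical values `Q` (over pairs with `a₀ < b₀`) and cells `cell w ∈ C`
  obtain ⟨F, hF⟩ : ∃ F : Finset ((Fin 2 →₀ ℕ) × (Fin 2 →₀ ℕ)),
      F = (U ×ˢ U).filter (fun p => p.1 0 < p.2 0) := ⟨_, rfl⟩
  obtain ⟨Q, hQ⟩ : ∃ Q : Finset ℚ,
      Q = F.image (fun p => ((p.1 1 : ℚ) - p.2 1) / ((p.2 0 : ℚ) - p.1 0)) := ⟨_, rfl⟩
  obtain ⟨cell, hcell⟩ : ∃ cell : (Fin 2 → ℤ) → ℕ × Bool, ∀ w, cell w =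
      ((Q.filter (· < (w 0 : ℚ) / w 1)).card, decide ((w 0 : ℚ) / w 1 ∈ Q)) :=
    ⟨_, fun _ => rfl⟩
  obtain ⟨C, hC⟩ : ∃ C : Finset (ℕ × Bool), C = Finset.range (Q.card + 1) ×ˢ Finset.univ :=
    ⟨_, rfl⟩
  -- Step 1: the cell of `w` determines the weak order on `U`, hence `Rw w`
  have key : ∀ w w' : Fin 2 → ℤ, 0 < w 1 → 0 < w' 1 → cell w = cell w' → Rw w = Rw w' := by
    intro w w' hw hw' hc
    rw [hcell, hcell, Prod.mk.injEq, decide_eq_decide] at hc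
    refine hdep w w' fun a ha b hb => ?_
    rw [cmp_iff_ratio w hw a b, cmp_iff_ratio w' hw' a b]
    refine ratio_cmp_transfer _ _ a b fun hab => trichotomy_of_cell_eq Q _ _ hc.1 hc.2 ?_
    rw [hQ, Finset.mem_image]
    rcases lt_or_gt_of_ne hab with hlt | hgt
    · refine ⟨(a, b), ?_, rfl⟩
      rw [hF, Finset.mem_filter, Finset.mem_product]
      exact ⟨⟨ha, hb⟩, hlt⟩
    · refine ⟨(b, a), ?_, ?_⟩
      · rw [hF, Finset.mem_filter, Finset.mem_product]
        exact ⟨⟨hb, ha⟩, hgt⟩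
      · simp only
        rw [← neg_sub (a 1 : ℚ) (b 1), ← neg_sub (b 0 : ℚ) (a 0), neg_div_neg_eq]
  have hCcard : C.card ≤ U.card ^ 2 + 2 := by
    have hQF : Q.card ≤ F.card := hQ ▸ Finset.card_image_le
    have hF2 : 2 * F.card ≤ U.card ^ 2 := hF ▸ two_mul_card_filter_lt_le U
    rw [hC, Finset.card_product, Finset.card_range, Finset.card_univ, Fintype.card_bool]
    omega
  have hcellC : ∀ w, cell w ∈ C := fun w => by
    rw [hC, Finset.mem_product, Finset.mem_range, hcell]
    exact ⟨Nat.lt_succ_of_le (Finset.card_filter_le _ _), Finset.mem_univ _⟩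
  -- one positive weight `rep κ` per realised cell `κ`
  have hrep0 : ∀ κ : ℕ × Bool, ∃ w : Fin 2 → ℤ,
      (∃ w₀ : Fin 2 → ℤ, 0 < w₀ 0 ∧ 0 < w₀ 1 ∧ cell w₀ = κ) → 0 < w 0 ∧ 0 < w 1 ∧ cell w = κ := by
    intro κ
    by_cases h : ∃ w₀ : Fin 2 → ℤ, 0 < w₀ 0 ∧ 0 < w₀ 1 ∧ cell w₀ = κ
    · obtain ⟨w, hw⟩ := h
      exact ⟨w, fun _ => hw⟩
    · exact ⟨0, fun h' => absurd h' h⟩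
  choose rep hrep using hrep0
  -- Step 2: candidate exponents over a letter set `R` of size `≤ d`
  obtain ⟨T, hT⟩ : ∃ T : Finset (Fin 2 →₀ ℕ) → Finset (Fin 2 →₀ ℕ), ∀ R, T R =
      ((Finset.range (d + 1)).biUnion (fun j => R.finsuppAntidiag j)).image
        (fun m : (Fin 2 →₀ ℕ) →₀ ℕ => m.sum fun a k => k • a) := ⟨_, fun _ => rfl⟩
  have hTcard : ∀ R : Finset (Fin 2 →₀ ℕ), R.card ≤ d → (T R).card ≤ (d + 1) * 4 ^ d := by
    intro R hR
    rw [hT]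
    calc _ ≤ ((Finset.range (d + 1)).biUnion (fun j => R.finsuppAntidiag j)).card :=
          Finset.card_image_le
      _ ≤ ∑ j ∈ Finset.range (d + 1), (R.finsuppAntidiag j).card := Finset.card_biUnion_le
      _ ≤ ∑ _j ∈ Finset.range (d + 1), 4 ^ d := Finset.sum_le_sum fun j hj => ?_
      _ = (d + 1) * 4 ^ d := by rw [Finset.sum_const, Finset.card_range, smul_eq_mul]
    rw [Finset.card_finsuppAntidiag_nat_eq_choose]
    have hj : j < d + 1 := Finset.mem_range.mp hj
    calc (R.card + j - 1).choose j ≤ 2 ^ (R.card + j - 1) := Nat.choose_le_two_pow _ _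
      _ ≤ 2 ^ (2 * d) := Nat.pow_le_pow_right (by norm_num) (by omega)
      _ = 4 ^ d := by rw [pow_mul]; norm_num
  -- the target set lies in the finite union of the candidates over the realised cells
  refine (Set.ncard_le_ncard (t := ↑(C.biUnion fun κ => T (Rw (rep κ)))) ?_
    (Finset.finite_toSet _)).trans ?_
  · rintro e ⟨w, hw0, hw1, m, hmR, hmd, rfl⟩
    obtain ⟨-, h1, hc⟩ := hrep (cell w) ⟨w, hw0, hw1, rfl⟩
    have hRw : Rw w = Rw (rep (cell w)) := key w _ hw1 h1 hc.symm
    rw [Finset.mem_coe, Finset.mem_biUnion]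
    refine ⟨cell w, hcellC w, ?_⟩
    rw [hT, Finset.mem_image]
    exact ⟨m, Finset.mem_biUnion.mpr ⟨_, Finset.mem_range.mpr (Nat.lt_succ_of_le hmd),
      Finset.mem_finsuppAntidiag'.mpr ⟨rfl, hmR.trans (Finset.subset_of_eq hRw)⟩⟩, rfl⟩
  · rw [Set.ncard_coe_finset]
    calc _ ≤ ∑ κ ∈ C, (T (Rw (rep κ))).card := Finset.card_biUnion_le
      _ ≤ ∑ _κ ∈ C, (d + 1) * 4 ^ d := Finset.sum_le_sum fun κ _ => hTcard _ (hcard _)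
      _ = C.card * ((d + 1) * 4 ^ d) := by rw [Finset.sum_const, smul_eq_mul]
      _ ≤ (U.card ^ 2 + 2) * ((d + 1) * 4 ^ d) := Nat.mul_le_mul_right _ hCcard

end Summit.ValiantsHypothesis.ValiantsHypothesis.Theorems.TwoProducts.DissocCount
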